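import Literature.NumberTheory.LFunctions.MertensTail
import Mathlib.Analysis.SpecialFunctions.Trigonometric.Deriv
import HarnessLib

/-!
# `Σ_{P < p ≤ Q} cos(h log p)/p` is bounded, and `Σ sin²(½ h log p)/p` grows like `½ log(log Q/log P)`

Trunk T-ANT (`Literature/NumberTheory/LFunctions`), continuing `MertensTail.lean`. Proofs only.
For `h > 0` and `2 ≤ P ≤ Q`, partial summation against the two-sided Mertens I bound
`S(t) = Σ_{p ≤ t} log p/p ∈ [log t − 4, log t + 2]`
(`Literature.NumberTheory.LFunctions.MertensBound.sum_log_div_prime_bounds`) with the weight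
`f(t) = cos(h log t)/log t` gives

  `|Σ_{P < p ≤ Q} cos(h log p)/p| ≤ 12/log P + 3/(h log P) + 4h log(log Q/log P)`

(`abs_sum_cos_log_div_prime_le`): the main terms `±cos(h log t)` from the boundary and from
`∫ h sin(h log t) dt/t` cancel, the oscillatory integral `∫_P^Q cos(h log t) dt/(t log t) =
∫_{h log P}^{h log Q} cos v dv/v` is at most `3/(h log P)` (`abs_integral_cos_log_div_le`), and the
error `τ(t) = S(t) − log t`, `|τ| ≤ 4`, contributes `≤ 4/log P + 4/log Q + 4∫|f'| log-free`.
Combined with the tail form of Mertens II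
(`Literature.NumberTheory.LFunctions.MertensBound.loglog_sub_loglog_le_sum_inv_prime`) this yields
the lower bound

  `Σ_{P < p ≤ Q} sin²(½ h log p)/p ≥ ½ log(log Q/log P) − 9/log P − 3/(2h log P) − 2h log(log Q/log P)`

(`sum_sin_sq_log_div_prime_ge`), i.e. `≍ ½ log(h log Q)` once `h log P ≍ 1`: the variance of the
prime trigonometric polynomial approximating `S(t+h) − S(t)` (Selberg 1946; Fujii 1975; Tsang
1986; Titchmarsh §9.25 (9.25.2)), for the programme recorded in `SelbergFujiiSmallGaps.lean`.

## References

* G. H. Hardy, E. M. Wright, *An Introduction to the Theory of Numbers*, 6th ed. (2008), Thm 425,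
  Thm 427 (§22.6–22.7). [key `HardyWright2008`]
* E. C. Titchmarsh, *The Theory of the Riemann Zeta-Function*, 2nd ed. (1986), §9.25.
  [key `Titchmarsh1986`]
-/

noncomputable section

open Finset Nat Real MeasureTheory Set

namespace Literature.NumberTheory.LFunctions.MertensBound

/-! ### The oscillatory integral `∫ cos(h log t) dt/(t log t)` -/

/-- For `h > 0` and `1 < P ≤ Q`: `|∫_P^Q cos(h log t)/(t log t) dt| ≤ 3/(h log P)`. With
`G(t) = sin(h log t)/(h log t)` one has `G' = cos(h log t)/(t log t) − sin(h log t)/(h t log² t)`,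
so the integral is `G(Q) − G(P) + ∫ sin(h log t)/(h t log² t)`, each piece at most `1/(h log P)`.
[folklore] -/
theorem abs_integral_cos_log_div_le {h P Q : ℝ} (hh : 0 < h) (hP : 1 < P) (hPQ : P ≤ Q) :
    |∫ t in P..Q, Real.cos (h * Real.log t) / (t * Real.log t)| ≤ 3 / (h * Real.log P) := by
  have hlogP : 0 < Real.log P := Real.log_pos hP
  have hmemI : ∀ t ∈ Set.Icc P Q, 1 < t := fun t ht ↦ hP.trans_le ht.1
  set G : ℝ → ℝ := fun t ↦ Real.sin (h * Real.log t) / (h * Real.log t) with hG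
  set g₁ : ℝ → ℝ := fun t ↦ Real.cos (h * Real.log t) / (t * Real.log t) with hg₁
  set g₂ : ℝ → ℝ := fun t ↦ Real.sin (h * Real.log t) / (h * t * Real.log t ^ 2) with hg₂
  have hGderiv : ∀ t : ℝ, 1 < t → HasDerivAt G (g₁ t - g₂ t) t := by
    intro t ht
    have ht0 : t ≠ 0 := by linarith
    have hl : Real.log t ≠ 0 := (Real.log_pos ht).ne'
    have hhl : h * Real.log t ≠ 0 := mul_ne_zero hh.ne' hl
    have h1 : HasDerivAt (fun t ↦ h * Real.log t) (h * t⁻¹) t :=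
      (Real.hasDerivAt_log ht0).const_mul h
    have h2 : HasDerivAt (fun t ↦ Real.sin (h * Real.log t)) (Real.cos (h * Real.log t) * (h * t⁻¹)) t :=
      h1.sin
    have h3 := h2.div h1 hhl
    refine h3.congr_deriv ?_
    simp only [hg₁, hg₂]
    field_simp
  have hcont₁ : ContinuousOn g₁ (Set.Icc P Q) := by
    intro t ht
    have ht1 := hmemI t ht
    have ht0 : t ≠ 0 := by linarith
    have hl : Real.log t ≠ 0 := (Real.log_pos ht1).ne'
    exact ((Real.continuous_cos.continuousAt.comp
      ((Real.continuousAt_log ht0).const_mul h)).div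
      (continuousAt_id.mul (Real.continuousAt_log ht0)) (mul_ne_zero ht0 hl)).continuousWithinAt
  have hcont₂ : ContinuousOn g₂ (Set.Icc P Q) := by
    intro t ht
    have ht1 := hmemI t ht
    have ht0 : t ≠ 0 := by linarith
    have hl : Real.log t ≠ 0 := (Real.log_pos ht1).ne'
    exact ((Real.continuous_sin.continuousAt.comp
      ((Real.continuousAt_log ht0).const_mul h)).div
      ((continuousAt_const.mul continuousAt_id).mul ((Real.continuousAt_log ht0).pow 2))
      (mul_ne_zero (mul_ne_zero hh.ne' ht0) (pow_ne_zero _ hl))).continuousWithinAt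
  -- `∫ (g₁ − g₂) = G Q − G P`
  have hi12 : IntervalIntegrable (fun t ↦ g₁ t - g₂ t) volume P Q :=
    (hcont₁.sub hcont₂).intervalIntegrable_of_Icc hPQ
  have hi2 : IntervalIntegrable g₂ volume P Q := hcont₂.intervalIntegrable_of_Icc hPQ
  have hFTC : ∫ t in P..Q, (g₁ t - g₂ t) = G Q - G P :=
    intervalIntegral.integral_eq_sub_of_hasDerivAt
      (fun t ht ↦ hGderiv t (hmemI t (by rwa [Set.uIcc_of_le hPQ] at ht))) hi12
  have hsplit : ∫ t in P..Q, g₁ t = (G Q - G P) + ∫ t in P..Q, g₂ t := by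
    rw [← hFTC, ← intervalIntegral.integral_add hi12 hi2]
    exact intervalIntegral.integral_congr fun t _ ↦ by ring
  -- bounds for the three pieces
  have hGle : ∀ t, P ≤ t → |G t| ≤ 1 / (h * Real.log P) := by
    intro t ht
    have hlt : 0 < Real.log t := hlogP.trans_le (Real.log_le_log (by linarith) ht)
    rw [hG, abs_div, abs_of_pos (mul_pos hh hlt)]
    calc |Real.sin (h * Real.log t)| / (h * Real.log t) ≤ 1 / (h * Real.log t) :=
          div_le_div_of_nonneg_right (Real.abs_sin_le_one _) (mul_pos hh hlt).le
      _ ≤ 1 / (h * Real.log P) := by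
          apply one_div_le_one_div_of_le (mul_pos hh hlogP)
          exact mul_le_mul_of_nonneg_left (Real.log_le_log (by linarith) ht) hh.le
  have hI₂ : |∫ t in P..Q, g₂ t| ≤ 1 / (h * Real.log P) := by
    -- `|g₂| ≤ (1/h) · 1/(t log² t)` and `∫_P^Q dt/(t log² t) = 1/log P − 1/log Q`
    set w : ℝ → ℝ := fun t ↦ t⁻¹ / Real.log t ^ 2 with hw
    have hwcont : ContinuousOn w (Set.Icc P Q) := by
      intro t ht
      have ht1 := hmemI t ht
      have ht0 : t ≠ 0 := by linarith
      exact ((continuousAt_inv₀ ht0).div ((Real.continuousAt_log ht0).pow 2)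
        (pow_ne_zero _ (Real.log_pos ht1).ne')).continuousWithinAt
    have hWderiv : ∀ t : ℝ, 1 < t → HasDerivAt (fun t ↦ -(Real.log t)⁻¹) (w t) t := by
      intro t ht
      have ht0 : t ≠ 0 := by linarith
      have hl : Real.log t ≠ 0 := (Real.log_pos ht).ne'
      have := ((Real.hasDerivAt_log ht0).inv hl).neg
      refine this.congr_deriv ?_
      simp only [hw]; field_simp
    have hWFTC : ∫ t in P..Q, w t = -(Real.log Q)⁻¹ - -(Real.log P)⁻¹ :=
      intervalIntegral.integral_eq_sub_of_hasDerivAt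
        (fun t ht ↦ hWderiv t (hmemI t (by rwa [Set.uIcc_of_le hPQ] at ht)))
        (hwcont.intervalIntegrable_of_Icc hPQ)
    have hbound : ∀ t ∈ Set.Icc P Q, |g₂ t| ≤ h⁻¹ * w t := by
      intro t ht
      have ht1 := hmemI t ht
      have ht0 : 0 < t := by linarith
      have hlt : 0 < Real.log t := Real.log_pos ht1
      rw [hg₂, hw, abs_div, abs_of_pos (by positivity : 0 < h * t * Real.log t ^ 2)]
      calc |Real.sin (h * Real.log t)| / (h * t * Real.log t ^ 2) ≤ 1 / (h * t * Real.log t ^ 2) :=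
            div_le_div_of_nonneg_right (Real.abs_sin_le_one _) (by positivity)
        _ = h⁻¹ * (t⁻¹ / Real.log t ^ 2) := by field_simp
    have h1 := intervalIntegral.abs_integral_le_integral_abs (μ := volume) hPQ (f := g₂)
    have h2 : ∫ t in P..Q, |g₂ t| ≤ ∫ t in P..Q, h⁻¹ * w t :=
      intervalIntegral.integral_mono_on hPQ ((hcont₂.abs).intervalIntegrable_of_Icc hPQ)
        ((hwcont.intervalIntegrable_of_Icc hPQ).const_mul _) hbound
    rw [intervalIntegral.integral_const_mul, hWFTC] at h2
    have hlogQ : 0 < Real.log Q := hlogP.trans_le (Real.log_le_log (by linarith) hPQ)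
    have h3 : h⁻¹ * (-(Real.log Q)⁻¹ - -(Real.log P)⁻¹) ≤ 1 / (h * Real.log P) := by
      rw [show h⁻¹ * (-(Real.log Q)⁻¹ - -(Real.log P)⁻¹) = 1 / (h * Real.log P) - 1 / (h * Real.log Q)
        by field_simp; ring]
      have : 0 ≤ 1 / (h * Real.log Q) := by positivity
      linarith
    exact h1.trans (h2.trans h3)
  rw [hsplit]
  have hGQ := hGle Q hPQ
  have hGP := hGle P le_rfl
  calc |G Q - G P + ∫ t in P..Q, g₂ t| ≤ |G Q| + |G P| + |∫ t in P..Q, g₂ t| := by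
        have := abs_add_le (G Q - G P) (∫ t in P..Q, g₂ t)
        have := abs_sub (G Q) (G P)
        linarith
    _ ≤ 1 / (h * Real.log P) + 1 / (h * Real.log P) + 1 / (h * Real.log P) := by
        gcongr
    _ = 3 / (h * Real.log P) := by ring

/-! ### The prime sum `Σ cos(h log p)/p` by partial summation -/

/-- **`Σ_{P < p ≤ Q} cos(h log p)/p` is bounded**: for `h > 0` and `2 ≤ P ≤ Q`,
`|Σ_{P < p ≤ Q} cos(h log p)/p| ≤ 12/log P + 3/(h log P) + 4h log(log Q/log P)`.
Partial summation (Hardy–Wright §22.7) of `c_p = log p/p` against `f(t) = cos(h log t)/log t`,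
with `S(t) = Σ_{p≤t} log p/p = log t + τ(t)`, `|τ| ≤ 4`
(`sum_log_div_prime_bounds`): the terms `±cos(h log ·)` cancel between the boundary and
`∫ h sin(h log t) dt/t`, leaving the oscillatory integral of `abs_integral_cos_log_div_le` and the
`τ`-terms. [cite: HardyWright2008, Thm 427 (§22.7)] -/
theorem abs_sum_cos_log_div_prime_le {h P Q : ℝ} (hh : 0 < h) (hP : 2 ≤ P) (hPQ : P ≤ Q) :
    |∑ p ∈ (Finset.Ioc ⌊P⌋₊ ⌊Q⌋₊).filter Nat.Prime, Real.cos (h * Real.log p) / p| ≤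
      12 / Real.log P + 3 / (h * Real.log P) + 4 * h * Real.log (Real.log Q / Real.log P) := by
  have hP0 : (0 : ℝ) ≤ P := by linarith
  have hP1 : (1 : ℝ) < P := by linarith
  have hQ : 2 ≤ Q := hP.trans hPQ
  have hmemI : ∀ t ∈ Set.Icc P Q, 1 < t := fun t ht ↦ hP1.trans_le ht.1
  have hlogP : 0 < Real.log P := Real.log_pos hP1
  have hlogQ : 0 < Real.log Q := Real.log_pos (by linarith)
  have hlogPQ : Real.log P ≤ Real.log Q := Real.log_le_log (by linarith) hPQ
  -- the weights
  set c : ℕ → ℝ := fun k ↦ if k.Prime then Real.log k / k else 0 with hc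
  set f : ℝ → ℝ := fun t ↦ Real.cos (h * Real.log t) / Real.log t with hf
  set g : ℝ → ℝ := fun t ↦ -(h * Real.sin (h * Real.log t)) / (t * Real.log t) -
    Real.cos (h * Real.log t) / (t * Real.log t ^ 2) with hg
  have hderiv : ∀ t : ℝ, 1 < t → HasDerivAt f (g t) t := by
    intro t ht
    have ht0 : t ≠ 0 := by linarith
    have hl : Real.log t ≠ 0 := (Real.log_pos ht).ne'
    have h1 : HasDerivAt (fun t ↦ h * Real.log t) (h * t⁻¹) t :=
      (Real.hasDerivAt_log ht0).const_mul h
    have h2 := (h1.cos).div (Real.hasDerivAt_log ht0) hl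
    refine h2.congr_deriv ?_
    simp only [hg]; field_simp
  have hmem : ∀ t ∈ Set.Icc P Q, t ∈ ({0}ᶜ : Set ℝ) := fun t ht ↦
    Set.mem_compl_singleton_iff.mpr (show (0 : ℝ) < t by linarith [ht.1]).ne'
  have hlogne : ∀ t ∈ Set.Icc P Q, Real.log t ≠ 0 := fun t ht ↦ (Real.log_pos (hmemI t ht)).ne'
  have hgcont : ContinuousOn g (Set.Icc P Q) := by
    intro t ht
    have ht0 : t ≠ 0 := by linarith [ht.1]
    have hl := hlogne t ht
    have hL := Real.continuousAt_log ht0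
    have hhl : ContinuousAt (fun t ↦ h * Real.log t) t := hL.const_mul h
    refine ContinuousAt.continuousWithinAt ?_
    refine ((((Real.continuous_sin.continuousAt.comp hhl).const_mul h).neg.div
      (continuousAt_id.mul hL) (mul_ne_zero ht0 hl))).sub
      ((Real.continuous_cos.continuousAt.comp hhl).div (continuousAt_id.mul (hL.pow 2))
        (mul_ne_zero ht0 (pow_ne_zero _ hl)))
  have hf_diff : ∀ t ∈ Set.Icc P Q, DifferentiableAt ℝ f t := fun t ht ↦
    (hderiv t (hmemI t ht)).differentiableAt
  have hderiv_eq : Set.EqOn g (deriv f) (Set.Icc P Q) := fun t ht ↦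
    ((hderiv t (hmemI t ht)).deriv).symm
  have hg_int : IntegrableOn g (Set.Icc P Q) := hgcont.integrableOn_Icc
  have hf_int : IntegrableOn (deriv f) (Set.Icc P Q) :=
    hg_int.congr_fun hderiv_eq measurableSet_Icc
  -- Abel summation
  have habel := sum_mul_eq_sub_sub_integral_mul c hP0 hPQ hf_diff hf_int
  have hlhs : ∑ k ∈ Finset.Ioc ⌊P⌋₊ ⌊Q⌋₊, f k * c k =
      ∑ p ∈ (Finset.Ioc ⌊P⌋₊ ⌊Q⌋₊).filter Nat.Prime, Real.cos (h * Real.log p) / p := by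
    rw [Finset.sum_filter]
    refine Finset.sum_congr rfl fun k _ ↦ ?_
    simp only [hc]
    split_ifs with hk
    · have hk1 : (1 : ℝ) < k := by exact_mod_cast hk.one_lt
      have : Real.log k ≠ 0 := (Real.log_pos hk1).ne'
      show Real.cos (h * Real.log k) / Real.log k * (Real.log k / k) = Real.cos (h * Real.log k) / k
      field_simp
    · simp
  -- the partial sums `S(t) = log t + τ(t)`, `|τ| ≤ 4`
  set Sf : ℝ → ℝ := fun t ↦ ∑ k ∈ Finset.Icc 0 ⌊t⌋₊, c k with hSf
  have hS : ∀ t : ℝ, 1 ≤ t → |Sf t - Real.log t| ≤ 4 := by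
    intro t ht
    have := sum_log_div_prime_bounds ht
    rw [hSf]; simp only [hc]; rw [sum_Icc_ite_prime_log_div, abs_le]
    constructor <;> linarith [this.1, this.2]
  -- boundary terms: `f X * S X = cos(h log X) + cos(h log X) τ(X)/log X`
  have hbdry : ∀ X : ℝ, P ≤ X → |f X * Sf X - Real.cos (h * Real.log X)| ≤ 4 / Real.log P := by
    intro X hX
    have hlX : 0 < Real.log X := hlogP.trans_le (Real.log_le_log (by linarith) hX)
    have e : f X * Sf X - Real.cos (h * Real.log X) =
        Real.cos (h * Real.log X) / Real.log X * (Sf X - Real.log X) := by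
      simp only [hf]; field_simp
    rw [e, abs_mul, abs_div, abs_of_pos hlX]
    calc |Real.cos (h * Real.log X)| / Real.log X * |Sf X - Real.log X|
        ≤ 1 / Real.log X * 4 := mul_le_mul (div_le_div_of_nonneg_right (Real.abs_cos_le_one _) hlX.le)
          (hS X (by linarith)) (abs_nonneg _) (by positivity)
      _ ≤ 1 / Real.log P * 4 := by
          gcongr
      _ = 4 / Real.log P := by ring
  -- the integral: `∫ g S = ∫ g log + ∫ g τ`
  have hI_int : IntegrableOn (fun t ↦ g t * Sf t) (Set.Icc P Q) :=
    integrableOn_mul_sum_Icc c hP0 hg_int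
  have hglog_cont : ContinuousOn (fun t ↦ g t * Real.log t) (Set.Icc P Q) :=
    hgcont.mul (Real.continuousOn_log.mono hmem)
  -- `∫_P^Q g(t) log t dt = cos(h log Q) − cos(h log P) − ∫ cos(h log t)/(t log t)`
  have hmain : ∫ t in P..Q, g t * Real.log t =
      (Real.cos (h * Real.log Q) - Real.cos (h * Real.log P)) -
        ∫ t in P..Q, Real.cos (h * Real.log t) / (t * Real.log t) := by
    have hcos : ∀ t : ℝ, 1 < t → HasDerivAt (fun t ↦ Real.cos (h * Real.log t))
        (-(h * Real.sin (h * Real.log t)) / t) t := by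
      intro t ht
      have ht0 : t ≠ 0 := by linarith
      have := ((Real.hasDerivAt_log ht0).const_mul h).cos
      refine this.congr_deriv ?_
      field_simp
    have hc1 : ContinuousOn (fun t ↦ -(h * Real.sin (h * Real.log t)) / t) (Set.Icc P Q) := by
      intro t ht
      have ht0 : t ≠ 0 := by linarith [ht.1]
      exact ((((Real.continuous_sin.continuousAt.comp ((Real.continuousAt_log ht0).const_mul h)).const_mul h).neg).div
        continuousAt_id ht0).continuousWithinAt
    have hc2 : ContinuousOn (fun t ↦ Real.cos (h * Real.log t) / (t * Real.log t)) (Set.Icc P Q) := by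
      intro t ht
      have ht0 : t ≠ 0 := by linarith [ht.1]
      exact ((Real.continuous_cos.continuousAt.comp ((Real.continuousAt_log ht0).const_mul h)).div
        (continuousAt_id.mul (Real.continuousAt_log ht0)) (mul_ne_zero ht0 (hlogne t ht))).continuousWithinAt
    have hFTC : ∫ t in P..Q, -(h * Real.sin (h * Real.log t)) / t =
        Real.cos (h * Real.log Q) - Real.cos (h * Real.log P) :=
      intervalIntegral.integral_eq_sub_of_hasDerivAt
        (fun t ht ↦ hcos t (hmemI t (by rwa [Set.uIcc_of_le hPQ] at ht)))
        (hc1.intervalIntegrable_of_Icc hPQ)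
    rw [← hFTC, ← intervalIntegral.integral_sub (hc1.intervalIntegrable_of_Icc hPQ)
      (hc2.intervalIntegrable_of_Icc hPQ)]
    refine intervalIntegral.integral_congr fun t ht ↦ ?_
    rw [Set.uIcc_of_le hPQ] at ht
    have ht0 : t ≠ 0 := by linarith [ht.1]
    have hl := hlogne t ht
    simp only [hg]
    field_simp
  -- `|∫ g τ| ≤ 4 (h log(log Q/log P) + 1/log P)`
  have herr : |∫ t in P..Q, g t * (Sf t - Real.log t)| ≤
      4 * (h * Real.log (Real.log Q / Real.log P) + 1 / Real.log P) := by
    -- `|g t| ≤ h/(t log t) + 1/(t log² t) =: w t`, `∫ w = h (loglog Q − loglog P) + 1/log P − 1/log Q`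
    set w : ℝ → ℝ := fun t ↦ h * (t⁻¹ / Real.log t) + t⁻¹ / Real.log t ^ 2 with hw
    have hwcont : ContinuousOn w (Set.Icc P Q) := by
      intro t ht
      have ht0 : t ≠ 0 := by linarith [ht.1]
      have hl := hlogne t ht
      have hL := Real.continuousAt_log ht0
      exact ((((continuousAt_inv₀ ht0).div hL hl).const_mul h).add
        ((continuousAt_inv₀ ht0).div (hL.pow 2) (pow_ne_zero _ hl))).continuousWithinAt
    have hWderiv : ∀ t : ℝ, 1 < t →
        HasDerivAt (fun t ↦ h * Real.log (Real.log t) - (Real.log t)⁻¹) (w t) t := by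
      intro t ht
      have ht0 : t ≠ 0 := by linarith
      have hl : Real.log t ≠ 0 := (Real.log_pos ht).ne'
      have hA := ((Real.hasDerivAt_log ht0).log hl).const_mul h
      have hB := ((Real.hasDerivAt_log ht0).inv hl)
      refine (hA.sub hB).congr_deriv ?_
      simp only [hw]; field_simp; ring
    have hWFTC : ∫ t in P..Q, w t = (h * Real.log (Real.log Q) - (Real.log Q)⁻¹) -
        (h * Real.log (Real.log P) - (Real.log P)⁻¹) :=
      intervalIntegral.integral_eq_sub_of_hasDerivAt
        (fun t ht ↦ hWderiv t (hmemI t (by rwa [Set.uIcc_of_le hPQ] at ht)))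
        (hwcont.intervalIntegrable_of_Icc hPQ)
    have hbound : ∀ t ∈ Set.Icc P Q, |g t * (Sf t - Real.log t)| ≤ 4 * w t := by
      intro t ht
      have ht1 := hmemI t ht
      have ht0 : 0 < t := by linarith
      have hlt : 0 < Real.log t := Real.log_pos ht1
      rw [abs_mul]
      have hgt : |g t| ≤ w t := by
        simp only [hg, hw]
        refine (abs_sub _ _).trans ?_
        gcongr
        · rw [abs_div, abs_neg, abs_mul, abs_of_pos hh, abs_of_pos (by positivity : 0 < t * Real.log t)]
          calc h * |Real.sin (h * Real.log t)| / (t * Real.log t) ≤ h * 1 / (t * Real.log t) := by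
                gcongr; exact Real.abs_sin_le_one _
            _ = h * (t⁻¹ / Real.log t) := by field_simp
        · rw [abs_div, abs_of_pos (by positivity : 0 < t * Real.log t ^ 2)]
          calc |Real.cos (h * Real.log t)| / (t * Real.log t ^ 2) ≤ 1 / (t * Real.log t ^ 2) :=
                div_le_div_of_nonneg_right (Real.abs_cos_le_one _) (by positivity)
            _ = t⁻¹ / Real.log t ^ 2 := by field_simp
      have hw0 : 0 ≤ w t := by simp only [hw]; positivity
      calc |g t| * |Sf t - Real.log t| ≤ w t * 4 :=
            mul_le_mul hgt (hS t ht1.le) (abs_nonneg _) hw0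
        _ = 4 * w t := by ring
    have hi : IntervalIntegrable (fun t ↦ g t * (Sf t - Real.log t)) volume P Q := by
      have e : (fun t ↦ g t * (Sf t - Real.log t)) = fun t ↦ g t * Sf t - g t * Real.log t := by
        ext t; ring
      rw [e]
      exact ((intervalIntegrable_iff_integrableOn_Ioc_of_le hPQ).2
        (hI_int.mono_set Set.Ioc_subset_Icc_self)).sub (hglog_cont.intervalIntegrable_of_Icc hPQ)
    have h1 := intervalIntegral.abs_integral_le_integral_abs (μ := volume) hPQ
      (f := fun t ↦ g t * (Sf t - Real.log t))
    have h2 : ∫ t in P..Q, |g t * (Sf t - Real.log t)| ≤ ∫ t in P..Q, 4 * w t :=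
      intervalIntegral.integral_mono_on hPQ (hi.abs) ((hwcont.intervalIntegrable_of_Icc hPQ).const_mul 4)
        hbound
    rw [intervalIntegral.integral_const_mul, hWFTC] at h2
    have e3 : 4 * (h * Real.log (Real.log Q) - (Real.log Q)⁻¹ - (h * Real.log (Real.log P) - (Real.log P)⁻¹)) =
        4 * (h * Real.log (Real.log Q / Real.log P) + 1 / Real.log P) - 4 / Real.log Q := by
      rw [Real.log_div hlogQ.ne' hlogP.ne']; field_simp; ring
    rw [e3] at h2
    have : 0 ≤ 4 / Real.log Q := by positivity
    linarith
  -- assemble: the integral in `habel` is `∫_{Ioc P Q} deriv f · S`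
  have hint_eq : ∫ t in Set.Ioc P Q, deriv f t * Sf t =
      (∫ t in P..Q, g t * Real.log t) + ∫ t in P..Q, g t * (Sf t - Real.log t) := by
    have h1 : ∫ t in Set.Ioc P Q, deriv f t * Sf t = ∫ t in Set.Ioc P Q, g t * Sf t := by
      refine setIntegral_congr_fun measurableSet_Ioc fun t ht ↦ ?_
      rw [hderiv_eq (Set.Ioc_subset_Icc_self ht)]
    rw [h1, ← intervalIntegral.integral_of_le hPQ,
      ← intervalIntegral.integral_add (hglog_cont.intervalIntegrable_of_Icc hPQ)]
    · exact intervalIntegral.integral_congr fun t _ ↦ by ring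
    · have e : (fun t ↦ g t * (Sf t - Real.log t)) = fun t ↦ g t * Sf t - g t * Real.log t := by
        ext t; ring
      rw [e]
      exact ((intervalIntegrable_iff_integrableOn_Ioc_of_le hPQ).2
        (hI_int.mono_set Set.Ioc_subset_Icc_self)).sub (hglog_cont.intervalIntegrable_of_Icc hPQ)
  have hosc := abs_integral_cos_log_div_le hh hP1 hPQ
  have hbQ : |f Q * (∑ k ∈ Finset.Icc 0 ⌊Q⌋₊, c k) - Real.cos (h * Real.log Q)| ≤ 4 / Real.log P :=
    hbdry Q hPQ
  have hbP : |f P * (∑ k ∈ Finset.Icc 0 ⌊P⌋₊, c k) - Real.cos (h * Real.log P)| ≤ 4 / Real.log P :=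
    hbdry P le_rfl
  rw [← hlhs, habel, hint_eq, hmain]
  -- everything is now explicit: the `cos` terms cancel
  set A := f Q * (∑ k ∈ Finset.Icc 0 ⌊Q⌋₊, c k) - Real.cos (h * Real.log Q) with hA
  set B := f P * (∑ k ∈ Finset.Icc 0 ⌊P⌋₊, c k) - Real.cos (h * Real.log P) with hB
  set Ic := ∫ t in P..Q, Real.cos (h * Real.log t) / (t * Real.log t) with hIc
  set E := ∫ t in P..Q, g t * (Sf t - Real.log t) with hE
  have key : f Q * (∑ k ∈ Finset.Icc 0 ⌊Q⌋₊, c k) - f P * (∑ k ∈ Finset.Icc 0 ⌊P⌋₊, c k) -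
      ((Real.cos (h * Real.log Q) - Real.cos (h * Real.log P) - Ic) + E) = A - B + Ic - E := by
    rw [hA, hB]; ring
  rw [key]
  have t1 : |A - B + Ic - E| ≤ |A| + |B| + |Ic| + |E| := by
    have u1 := abs_sub (A - B + Ic) E
    have u2 := abs_add_le (A - B) Ic
    have u3 := abs_sub A B
    linarith
  -- (`linarith` treats `a / x` as an atom: normalise the divisions first)
  simp only [div_eq_mul_inv, mul_inv] at hbQ hbP hosc herr ⊢
  linarith

/-! ### The variance sum `Σ sin²(½ h log p)/p` -/

/-- **Lower bound for `Σ_{P < p ≤ Q} sin²(½ h log p)/p`** (`h > 0`, `2 ≤ P ≤ Q`):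
`≥ ½ (log log Q − log log P) − 9/log P − 3/(2 h log P) − 2h log(log Q/log P)`, from
`sin²(x/2) = (1 − cos x)/2`, the tail form of Mertens II (`loglog_sub_loglog_le_sum_inv_prime`)
and `abs_sum_cos_log_div_prime_le`. For `h log P ≍ 1` and `h log Q = hτ` this is
`½ log(hτ) − O(1)`: the growth of the variance of `S(t+h) − S(t)` in (9.25.2).
[cite: Titchmarsh1986, §9.25 (9.25.2)] -/
theorem sum_sin_sq_log_div_prime_ge {h P Q : ℝ} (hh : 0 < h) (hP : 2 ≤ P) (hPQ : P ≤ Q) :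
    (Real.log (Real.log Q) - Real.log (Real.log P)) / 2 - 9 / Real.log P - 3 / (2 * h * Real.log P) -
        2 * h * Real.log (Real.log Q / Real.log P) ≤
      ∑ p ∈ (Finset.Ioc ⌊P⌋₊ ⌊Q⌋₊).filter Nat.Prime, Real.sin (h * Real.log p / 2) ^ 2 / p := by
  have h1 := loglog_sub_loglog_le_sum_inv_prime hP hPQ
  have h2 := abs_sum_cos_log_div_prime_le hh hP hPQ
  have hlogP : 0 < Real.log P := Real.log_pos (by linarith)
  set A := ∑ p ∈ (Finset.Ioc ⌊P⌋₊ ⌊Q⌋₊).filter Nat.Prime, (1 : ℝ) / p with hA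
  set B := ∑ p ∈ (Finset.Ioc ⌊P⌋₊ ⌊Q⌋₊).filter Nat.Prime, Real.cos (h * Real.log p) / p with hB
  have e : ∑ p ∈ (Finset.Ioc ⌊P⌋₊ ⌊Q⌋₊).filter Nat.Prime, Real.sin (h * Real.log p / 2) ^ 2 / p =
      A / 2 - B / 2 := by
    rw [hA, hB, Finset.sum_div, Finset.sum_div, ← Finset.sum_sub_distrib]
    refine Finset.sum_congr rfl fun p _ ↦ ?_
    rw [Real.sin_sq_eq_half_sub, show 2 * (h * Real.log p / 2) = h * Real.log p by ring]
    ring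
  rw [e]
  have h2' := (abs_le.1 h2).2
  simp only [div_eq_mul_inv, mul_inv] at h1 h2' ⊢
  linarith

end Literature.NumberTheory.LFunctions.MertensBound

end
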